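import Literature.NumberTheory.DiophantineGeometry.GenEllBelyiExponentRigidity
import Literature.NumberTheory.DiophantineGeometry.GenEllDeCriticalValuesFamily
import Literature.NumberTheory.DiophantineGeometry.GenEllPullbackConductor
import HarnessLib

/-!
# The degree floor of the noncritical Belyi map in the tree's transfer of [GenEll] Thm 2.1 (ii) ⇒ (i),
# and the resulting coefficient wall (sequel to the exponent-rigidity memo)

S. Mochizuki, *Arithmetic elliptic curves in general position*, Math. J. Okayama Univ. **52** (2010),
Theorem 2.1, proof pp. 12–13 [cite: MochizukiGenEll2010, Thm 2.1 proof pp.12–13]: the noncritical Belyi map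
of the compactness step is "a Belyi map … unramified over … [sending] the critical values … to `{0, 1, ∞}`".

WHAT THIS FILE ADDS to `GenEllBelyiExponentRigidity` (R-H round-2 exponent programme of the abc-iut cell,
EXP F2; that memo treats the Belyi degree `deg β` as a free parameter `≥ 1`).  In the tree's rendering of the
transfer (`GenEllMechanismForPlaces.mechanismFor_places`), the Belyi map `φ` on `ℙ¹` is produced by
`NoncriticalBelyi.exists_p1FiniteMap_noncritical_protect (DeCrit.critSetC k c) …` with, among its clauses,
(hAcusps) every element of the critical-value set `critSetC k c` of the family member `t_c` on the cover
`D_e` (`e = 2k+1`) is a root of `f·g·(f−g)` (`f/g = φ`), i.e. lies in the fibre `φ⁻¹{0,1,∞}`, and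
(hcount) that fibre has exactly `deg φ + 2` points (genus-`0` Riemann–Hurwitz for a Belyi map).  Hence the
DEGREE FLOOR `|critSetC k c| ≤ deg φ + 2` (§1) — an elementary fibre count, for EVERY Belyi map the
mechanism can use at the parameter `(k, c)`, uniformly in the configuration.  Since the extra-divisor
coefficient `B_c = ((deg φ + 2)(2k+4) − (6k+6))/(2k+1)` is monotone in `deg φ` while the margin
`A − B_c = (2k−2)/(2k+1)` is not (`slope_sub_eq`), the floor turns the memo's degree threshold into a wall
in terms of `N := |critSetC k c|` alone (§2–§3): if `(Λ − 1)·(N(2k+4) − (6k+6)) ≥ 2k − 2` then NO source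
coefficient `ε′ ≥ Λ − 1` satisfies the slope hypothesis `hslope` of
`vojtaIneq_mechanism_of_condBound_places`, whatever the configuration and whatever the Belyi map.

GENERIC COUNT (numerics, NOT a kernel fact; computed ≠ proved): `critSetC k c` is the image under
`tCritC` of the complex roots of `R_c` (degree `6k+6`, `card_critSetC_le`); for
`k ∈ {3,4,5,6,7,8,10}` and `c ∈ {1, 2, 1/2, 5/7, −3, 1/10, 7}` (49 pairs) an Aberth–Ehrlich root count in
double precision (relative residuals `≤ 1.2·10⁻¹⁵`, root separation `≥ 4.3·10⁻²`, critical-value separation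
`≥ 3.7·10⁻⁴`) finds `6k+6` distinct roots and `6k+6` DISTINCT critical values every time
(abc-iut cell, HOME/abc-iut-rh2-exp-lit/critset_count.py + .txt).  Under the generic count `N = 6k+6`
(hypothesis `hgen` below, never asserted) the wall reads `(Λ−1)·(6k+6)(2k+3) ≥ 2k−2`, and
`(2k−2)/((6k+6)(2k+3)) ≤ 1/54` for every `k` with equality at `k = 3` (§4): at every coefficient
`Λ ≥ 1 + 1/54 ≈ 1.0185` (`μ₀ = 1/Λ ≤ 54/55 ≈ 0.982`) the tree's transfer is void at EVERY ramification index
`e = 2k+1` and every configuration; just below, the output coefficient `Λ/(A − Λ·B_c)` is enormous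
(`> 50` at `Λ = 1.018`, `k = 3`), and at `Λ = 1.01` it still exceeds `3Λ` for every `k` (§4, last example) —
i.e. the transfer is dominated there by the transfer-free degree-one line of the programme (exponent `3/μ₀`).
This SUPERSEDES the instance rows "`deg β = 2` survives for `e ≥ 125` (`Λ = 1.91`) / `e ≥ 9` (`Λ = 1.30`)"
of the memo as far as the tree's mechanism is concerned: there `deg β ≥ 6k+4 = 3e+1` generically, never `2`.
What a loss-free transfer at `Λ > 1` would need is unchanged (an economical noncritical Belyi map: fibre over
`{0,1,∞}` of size `o(e)` missing the cusp fibre); nothing here says «(ii)_Λ ⇒ (i)_Λ» is false.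

* `card_le_belyi_deg_add_two`, `card_critSetC_le_belyi_deg_add_two` — the floor (§1);
* `belyi_Bc_mono`, `belyi_slope_not_pos_of_card`, `belyi_slope_not_pos_places_of_card` — the wall from a
  floor, in the binders of `vojtaIneq_of_belyi_mechanism` (`e`) and of `mechanismFor_places` (`k`) (§2);
* `belyi_mechanism_wall_of_card` — §1 + §2 on the package clauses themselves (§3);
* `belyi_wall_generic`, `belyi_mechanism_wall_generic` + `example`s — the generic count `N = 6k+6` (§4).

Theorems only (no definitions, no named facts); elementary.  [GenEll] is classical and refereed; the
statements concern carrying a coefficient through the tree's rendering of its PROOF; nothing bears on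
[IUTchIII] Cor. 3.12 and nothing asserts abc (with or without an exponent) proved or refuted.
-/

noncomputable section

open Polynomial

namespace Literature.NumberTheory.DiophantineGeometry.GenEll

/-! ## §1 The degree floor: the cusp-bound set sits in a fibre of `deg φ + 2` points -/

/-- **THE DEGREE FLOOR.** For the data `φ = f/g` of the noncritical-Belyi package (clauses of
`NoncriticalBelyi.exists_p1FiniteMap_noncritical_protect` as consumed by `mechanismFor_places`: the forms
`f`, `g`, `f − g` have exact degree `deg φ > 0`; every `a ∈ A` is a root of `f·g·(f−g)`; the complex roots of
`f·g·(f−g)` number `deg φ + 2`), the finite set `A` has at most `deg φ + 2` elements.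
[cite: MochizukiGenEll2010, Thm 2.1 proof p.12] -/
theorem card_le_belyi_deg_add_two (φ : P1FiniteMap) (hdeg : 0 < φ.deg)
    (hnum : φ.num.natDegree = φ.deg) (hden : φ.den.natDegree = φ.deg)
    (hsub : (φ.num - φ.den).natDegree = φ.deg) {A : Finset ℂ}
    (hAcusps : ∀ a ∈ A, aeval a (φ.num * φ.den * (φ.num - φ.den)) = 0)
    (hcount : ((φ.num * φ.den * (φ.num - φ.den)).map (Int.castRingHom ℂ)).roots.toFinset.card =
      φ.deg + 2) :
    A.card ≤ φ.deg + 2 := by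
  classical
  have hp0 : φ.num ≠ 0 := fun h => by
    rw [h, natDegree_zero] at hnum; omega
  have hq0 : φ.den ≠ 0 := fun h => by
    rw [h, natDegree_zero] at hden; omega
  have hpq0 : φ.num - φ.den ≠ 0 := fun h => by
    rw [h, natDegree_zero] at hsub; omega
  have hm0 : φ.num * φ.den * (φ.num - φ.den) ≠ 0 := mul_ne_zero (mul_ne_zero hp0 hq0) hpq0
  have hmC0 : (φ.num * φ.den * (φ.num - φ.den)).map (Int.castRingHom ℂ) ≠ 0 :=
    (Polynomial.map_ne_zero_iff (Int.castRingHom ℂ).injective_int).mpr hm0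
  rw [← hcount]
  refine Finset.card_le_card fun a ha => ?_
  rw [Multiset.mem_toFinset, mem_roots hmC0, IsRoot.def, eval_map, ← algebraMap_int_eq, ← aeval_def]
  exact hAcusps a ha

/-- **The floor at the mechanism's cusp-bound set**: every Belyi map `φ` that `mechanismFor_places` can use
at the parameter `(k, c)` — it must send the critical-value set `critSetC k c` of `t_c` into `{0,1,∞}` — has
`|critSetC k c| ≤ deg φ + 2`, uniformly in the configuration. [cite: MochizukiGenEll2010, Thm 2.1 proof p.12] -/
theorem card_critSetC_le_belyi_deg_add_two (k : ℕ) (c : ℚ) (φ : P1FiniteMap) (hdeg : 0 < φ.deg)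
    (hnum : φ.num.natDegree = φ.deg) (hden : φ.den.natDegree = φ.deg)
    (hsub : (φ.num - φ.den).natDegree = φ.deg)
    (hAcusps : ∀ a ∈ DeCrit.critSetC k c, aeval a (φ.num * φ.den * (φ.num - φ.den)) = 0)
    (hcount : ((φ.num * φ.den * (φ.num - φ.den)).map (Int.castRingHom ℂ)).roots.toFinset.card =
      φ.deg + 2) :
    (DeCrit.critSetC k c).card ≤ φ.deg + 2 :=
  card_le_belyi_deg_add_two φ hdeg hnum hden hsub hAcusps hcount

/-! ## §2 From a degree floor to the coefficient wall -/

/-- `B_c = ((n + 2)(e + 3) − 3e − 3)/e` is monotone in the Belyi degree `n` (`e > 0`).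
[cite: MochizukiGenEll2010, Thm 2.1 proof p.13] -/
theorem belyi_Bc_mono {n n' e : ℝ} (he : 0 < e) (h : n ≤ n') :
    ((n + 2) * (e + 3) - 3 * e - 3) / e ≤ ((n' + 2) * (e + 3) - 3 * e - 3) / e := by
  refine div_le_div_of_nonneg_right ?_ he.le
  nlinarith

/-- **The wall from a floor** (binders of `vojtaIneq_of_belyi_mechanism`: `A = n(e+3)/e`,
`B_c = ((n+2)(e+3) − 3e − 3)/e`, `A − B_c = (e−3)/e`): if the Belyi degree satisfies `N ≤ n + 2` and
`(Λ − 1)·(N(e+3) − 3e − 3) ≥ e − 3` (`Λ ≥ 1`), then for every source `ε′ ≥ Λ − 1` the slope hypothesis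
`0 < A − (1+ε′)·B_c` FAILS.  (`(Λ−1)·B_c(n) ≥ (Λ−1)·B_c(N−2) ≥ (e−3)/e = A − B_c`, then
`GenEllThm21With.belyi_slope_not_pos`.) [cite: MochizukiGenEll2010, Thm 2.1 proof p.13] -/
theorem belyi_slope_not_pos_of_card {n e ε' Λ N : ℝ} (he : 0 < e) (hn : 1 ≤ n) (hN : N ≤ n + 2)
    (hΛ : 1 ≤ Λ) (hwall : e - 3 ≤ (Λ - 1) * (N * (e + 3) - 3 * e - 3)) (hε' : Λ - 1 ≤ ε') :
    ¬ 0 < n * (e + 3) / e - (1 + ε') * (((n + 2) * (e + 3) - 3 * e - 3) / e) := by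
  refine belyi_slope_not_pos (belyi_Bc_nonneg hn he) hε' ?_
  rw [slope_sub_eq n e he.ne']
  have hmono : ((N - 2 + 2) * (e + 3) - 3 * e - 3) / e ≤ ((n + 2) * (e + 3) - 3 * e - 3) / e :=
    belyi_Bc_mono he (by linarith)
  have hΛ1 : 0 ≤ Λ - 1 := by linarith
  have h1 : (e - 3) / e ≤ (Λ - 1) * (((N - 2 + 2) * (e + 3) - 3 * e - 3) / e) := by
    rw [mul_div_assoc', div_le_div_iff_of_pos_right he]
    nlinarith
  exact h1.trans (mul_le_mul_of_nonneg_left hmono hΛ1)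

/-- **The same in the binders of `mechanismFor_places` / `vojtaIneq_mechanism_of_condBound_places`**
(`e = 2k+1`: `A = deg φ·(2k+4)/(2k+1)`, `B_c = ((deg φ + 2)(2k+4) − (6k+6))/(2k+1)`): a floor `N ≤ deg φ + 2`
with `(Λ−1)·(N(2k+4) − (6k+6)) ≥ 2k − 2` leaves no admissible source `ε′ ≥ Λ − 1`.
[cite: MochizukiGenEll2010, Thm 2.1 proof p.13] -/
theorem belyi_slope_not_pos_places_of_card {n N : ℕ} (k : ℕ) {ε' Λ : ℝ} (hn : 1 ≤ n) (hN : N ≤ n + 2)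
    (hΛ : 1 ≤ Λ) (hwall : (2 * k - 2 : ℝ) ≤ (Λ - 1) * ((N : ℝ) * (2 * k + 4) - (6 * k + 6)))
    (hε' : Λ - 1 ≤ ε') :
    ¬ 0 < (n : ℝ) * (2 * k + 4) / (2 * k + 1) -
        (1 + ε') * ((((n : ℝ) + 2) * (2 * k + 4) - (6 * k + 6)) / (2 * k + 1)) := by
  have he : (0 : ℝ) < 2 * k + 1 := by positivity
  have hN' : (N : ℝ) ≤ (n : ℝ) + 2 := by exact_mod_cast hN
  have h := belyi_slope_not_pos_of_card (n := (n : ℝ)) (e := 2 * k + 1) (N := (N : ℝ)) he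
    (by exact_mod_cast hn) hN' hΛ (by convert hwall using 1 <;> ring) hε'
  have hA : (n : ℝ) * (2 * k + 4) / (2 * k + 1) -
        (1 + ε') * ((((n : ℝ) + 2) * (2 * k + 4) - (6 * k + 6)) / (2 * k + 1)) =
      (n : ℝ) * (2 * k + 1 + 3) / (2 * k + 1) -
        (1 + ε') * ((((n : ℝ) + 2) * (2 * k + 1 + 3) - 3 * (2 * k + 1) - 3) / (2 * k + 1)) := by
    ring
  rw [hA]
  exact h

/-! ## §3 The wall on the package clauses themselves -/

/-- **THE MECHANISM'S COEFFICIENT WALL, uniformly in the configuration.** Fix the parameter `(k, c)` of the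
family `t_c` and a coefficient `Λ ≥ 1` with `(Λ − 1)·(|critSetC k c|·(2k+4) − (6k+6)) ≥ 2k − 2`.  Then for
EVERY Belyi datum `φ` satisfying the package clauses at `A := critSetC k c` (exact degrees, `critSetC k c`
inside the fibre over `{0,1,∞}`, that fibre of size `deg φ + 2`) and every source `ε′ ≥ Λ − 1`, the slope
hypothesis `hslope` of `vojtaIneq_mechanism_of_condBound_places` fails — whatever configuration the map was
chosen to protect. [cite: MochizukiGenEll2010, Thm 2.1 proof pp.12–13] -/
theorem belyi_mechanism_wall_of_card (k : ℕ) (c : ℚ) {Λ ε' : ℝ} (hΛ : 1 ≤ Λ)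
    (hwall : (2 * k - 2 : ℝ) ≤
      (Λ - 1) * (((DeCrit.critSetC k c).card : ℝ) * (2 * k + 4) - (6 * k + 6)))
    (hε' : Λ - 1 ≤ ε') (φ : P1FiniteMap) (hdeg : 0 < φ.deg)
    (hnum : φ.num.natDegree = φ.deg) (hden : φ.den.natDegree = φ.deg)
    (hsub : (φ.num - φ.den).natDegree = φ.deg)
    (hAcusps : ∀ a ∈ DeCrit.critSetC k c, aeval a (φ.num * φ.den * (φ.num - φ.den)) = 0)
    (hcount : ((φ.num * φ.den * (φ.num - φ.den)).map (Int.castRingHom ℂ)).roots.toFinset.card =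
      φ.deg + 2) :
    ¬ 0 < (φ.deg : ℝ) * (2 * k + 4) / (2 * k + 1) -
        (1 + ε') * ((((φ.deg : ℝ) + 2) * (2 * k + 4) - (6 * k + 6)) / (2 * k + 1)) :=
  belyi_slope_not_pos_places_of_card k hdeg
    (card_critSetC_le_belyi_deg_add_two k c φ hdeg hnum hden hsub hAcusps hcount) hΛ hwall hε'

/-! ## §4 The generic count `|critSetC k c| = 6k+6` (hypothesis `hgen`, numerics in the header) -/

/-- **The generic wall is `Λ ≥ 1 + 1/54`, uniformly in `k`**: `54·(2k−2) ≤ (6k+6)(2k+4) − (6k+6) =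
(6k+6)(2k+3)` for every natural `k` (equality at `k = 3`; the difference is `6(2k−7)(k−3)`), so
`Λ − 1 ≥ 1/54` gives the wall inequality with `N = 6k+6`. [cite: MochizukiGenEll2010, Thm 2.1 proof p.13] -/
theorem belyi_wall_generic (k : ℕ) {Λ : ℝ} (hΛ : 1 + 1 / 54 ≤ Λ) :
    (2 * k - 2 : ℝ) ≤ (Λ - 1) * ((6 * k + 6 : ℝ) * (2 * k + 4) - (6 * k + 6)) := by
  have hk : (0 : ℝ) ≤ k := Nat.cast_nonneg k
  have hpoly : (54 : ℝ) * (2 * k - 2) ≤ (6 * k + 6 : ℝ) * (2 * k + 4) - (6 * k + 6) := by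
    rcases le_or_gt k 3 with h3 | h4
    · have h3' : (k : ℝ) ≤ 3 := by exact_mod_cast h3
      nlinarith [mul_nonneg (sub_nonneg.2 h3') (by linarith : (0 : ℝ) ≤ 7 - 2 * k)]
    · have h4n : 4 ≤ k := by omega
      have h4' : (4 : ℝ) ≤ k := by exact_mod_cast h4n
      nlinarith [mul_nonneg (by linarith : (0 : ℝ) ≤ 2 * k - 7) (by linarith : (0 : ℝ) ≤ k - 3)]
  have hpos : (0 : ℝ) ≤ (6 * k + 6 : ℝ) * (2 * k + 4) - (6 * k + 6) := by nlinarith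
  have hΛ1 : (1 : ℝ) / 54 ≤ Λ - 1 := by linarith
  calc (2 * k - 2 : ℝ) ≤ 1 / 54 * ((6 * k + 6 : ℝ) * (2 * k + 4) - (6 * k + 6)) := by
        rw [div_mul_eq_mul_div, le_div_iff₀ (by norm_num : (0 : ℝ) < 54)]
        linarith
    _ ≤ (Λ - 1) * ((6 * k + 6 : ℝ) * (2 * k + 4) - (6 * k + 6)) :=
        mul_le_mul_of_nonneg_right hΛ1 hpos

/-- **THE GENERIC WALL OF THE TREE'S TRANSFER.** If the critical-value set of `t_c` has its generic size
`6k+6` (hypothesis `hgen`; `card_critSetC_le` is the opposite inequality; numerics in the header, never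
asserted here), then at every coefficient `Λ ≥ 1 + 1/54` no Belyi datum of the package at `(k, c)` admits
a source `ε′ ≥ Λ − 1`: the mechanism of `mechanismFor_places` transfers nothing from
`ABCCompactlyBoundedWith S Λ`, at every ramification index `e = 2k+1` and every configuration.
[cite: MochizukiGenEll2010, Thm 2.1 proof pp.12–13] -/
theorem belyi_mechanism_wall_generic (k : ℕ) (c : ℚ)
    (hgen : 6 * k + 6 ≤ (DeCrit.critSetC k c).card) {Λ ε' : ℝ} (hΛ : 1 + 1 / 54 ≤ Λ)
    (hε' : Λ - 1 ≤ ε') (φ : P1FiniteMap) (hdeg : 0 < φ.deg)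
    (hnum : φ.num.natDegree = φ.deg) (hden : φ.den.natDegree = φ.deg)
    (hsub : (φ.num - φ.den).natDegree = φ.deg)
    (hAcusps : ∀ a ∈ DeCrit.critSetC k c, aeval a (φ.num * φ.den * (φ.num - φ.den)) = 0)
    (hcount : ((φ.num * φ.den * (φ.num - φ.den)).map (Int.castRingHom ℂ)).roots.toFinset.card =
      φ.deg + 2) :
    ¬ 0 < (φ.deg : ℝ) * (2 * k + 4) / (2 * k + 1) -
        (1 + ε') * ((((φ.deg : ℝ) + 2) * (2 * k + 4) - (6 * k + 6)) / (2 * k + 1)) := by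
  have hΛ1 : (1 : ℝ) ≤ Λ := by linarith
  refine belyi_mechanism_wall_of_card k c hΛ1 ?_ hε' φ hdeg hnum hden hsub hAcusps hcount
  have hgen' : (6 * k + 6 : ℝ) ≤ ((DeCrit.critSetC k c).card : ℝ) := by exact_mod_cast hgen
  have hk : (0 : ℝ) ≤ k := Nat.cast_nonneg k
  have hΛ0 : (0 : ℝ) ≤ Λ - 1 := by linarith
  calc (2 * k - 2 : ℝ) ≤ (Λ - 1) * ((6 * k + 6 : ℝ) * (2 * k + 4) - (6 * k + 6)) :=
        belyi_wall_generic k hΛ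
    _ ≤ (Λ - 1) * (((DeCrit.critSetC k c).card : ℝ) * (2 * k + 4) - (6 * k + 6)) := by
        refine mul_le_mul_of_nonneg_left ?_ hΛ0
        have h := mul_le_mul_of_nonneg_right hgen' (by positivity : (0 : ℝ) ≤ 2 * k + 4)
        linarith

/-- `k = 3` (`e = 7`, `N = 24`) is where the generic wall `1 + 1/54` is attained: `54·4 = 24·10 − 24`.
[cite: MochizukiGenEll2010, Thm 2.1 proof p.13] -/
example : (54 : ℝ) * (2 * 3 - 2) = (6 * 3 + 6 : ℝ) * (2 * 3 + 4) - (6 * 3 + 6) := by norm_num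

/-- … and it is sharp there: at `k = 3`, the floor degree `deg φ = 22` and the source `1 + ε′ = 1.018 <
1 + 1/54` the slope `A − 1.018·B_c = (220 − 1.018·216)/7` IS positive — but the output coefficient
`1.018/(A − 1.018·B_c)` exceeds `50`. [cite: MochizukiGenEll2010, Thm 2.1 proof p.13] -/
example : 0 < (22 : ℝ) * (2 * 3 + 4) / (2 * 3 + 1) -
      1.018 * (((22 + 2 : ℝ) * (2 * 3 + 4) - (6 * 3 + 6)) / (2 * 3 + 1)) ∧
    50 < 1.018 / ((22 : ℝ) * (2 * 3 + 4) / (2 * 3 + 1) -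
      1.018 * (((22 + 2 : ℝ) * (2 * 3 + 4) - (6 * 3 + 6)) / (2 * 3 + 1))) := by
  constructor
  · norm_num
  · rw [lt_div_iff₀ (by norm_num)]
    norm_num

/-- **At `Λ = 1.01` the transfer is dominated by the degree-one line.** With the generic floor
`deg φ ≥ 6k+4` and any source `ε′ ≥ 0.01`, the slope is `< 1/3` for EVERY `k` (real `k ≥ 0`), so the output
coefficient `(1+ε′)/(A − (1+ε′)·B_c)`, when defined at all, exceeds `3·(1+ε′) ≥ 3Λ` — worse than the
exponent `3/μ₀` that the programme obtains on all triples without any Belyi map.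
[cite: MochizukiGenEll2010, Thm 2.1 proof p.13] -/
example (k n ε' : ℝ) (hk : 0 ≤ k) (hn : 6 * k + 4 ≤ n) (hε' : 0.01 ≤ ε') :
    n * (2 * k + 4) / (2 * k + 1) - (1 + ε') * (((n + 2) * (2 * k + 4) - (6 * k + 6)) / (2 * k + 1))
      < 1 / 3 := by
  have he : (0 : ℝ) < 2 * k + 1 := by linarith
  have hnum : n * (2 * k + 4) - (1 + ε') * ((n + 2) * (2 * k + 4) - (6 * k + 6)) <
      1 / 3 * (2 * k + 1) := by
    have hB : 0 ≤ (n + 2) * (2 * k + 4) - (6 * k + 6) := by nlinarith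
    have h1 : 1.01 * ((n + 2) * (2 * k + 4) - (6 * k + 6)) ≤
        (1 + ε') * ((n + 2) * (2 * k + 4) - (6 * k + 6)) :=
      mul_le_mul_of_nonneg_right (by linarith) hB
    have h2 : (6 * k + 4) * (2 * k + 4) ≤ n * (2 * k + 4) :=
      mul_le_mul_of_nonneg_right hn (by linarith)
    nlinarith [sq_nonneg (k - 4.3)]
  have hre : n * (2 * k + 4) / (2 * k + 1) -
      (1 + ε') * (((n + 2) * (2 * k + 4) - (6 * k + 6)) / (2 * k + 1)) =
      (n * (2 * k + 4) - (1 + ε') * ((n + 2) * (2 * k + 4) - (6 * k + 6))) / (2 * k + 1) := by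
    field_simp
  rw [hre, div_lt_iff₀ he]
  linarith

end Literature.NumberTheory.DiophantineGeometry.GenEll

end
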